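import Summits.Ventures.CertifiedArithmetic.LowPrec.SRDyadicGridSharp
import HarnessLib

/-!
# The product law is exact in the subnormal regime: `quantum · quantum` needs exactly `j` bits

HONEST FRAMING: certified error envelopes and provably optimal rounding/accumulation schemes for
low-precision formats under stated cost models; every table by two implementations; no hardware or
vendor claims.

File LXXXIV of the SR slice.  LXXXI bounded the random-bit cost of SR-rounding an exact product of
two format values by `max (m + 1) j` (`j = bias + m − 1`), LXXXIII (mixed) by
`max (m₁ + m₂ + 1 ∸ m) (j₁ + j₂ ∸ j)`; the `m + 1` term was shown attained for FP8 by kernel witnesses.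
Here the SUBNORMAL term is shown attained for EVERY format, structurally, from the closed form of
the bottom cell:

* **`pUp_valueSet_small`** — for `0 < δ < quantum`, `pUp (valueSet φ) δ = δ / quantum` (candidates `0`
  and `quantum`);
* **`valueSet_prod_law_sharp`** — the format value `quantum` times itself rounds with up-probability
  `2^−j`, a `j`-bit but not a `(j−1)`-bit dyadic (`j ≥ 2`): the `j` term of the product law is exact;
  hence the law `max (m+1) j` is EXACT whenever `j ≥ m + 1` — binary16 `24`, bfloat16 `133`,
  binary32 `149`, E4M3 `9`, E5M2 `16`, E3M2 `4` (`prod_law_exact_formats`, no enumeration);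
* **`valueSet_mixed_law_sharp`** — factors `quantum₁ ∈ valueSet φ₁`, `quantum₂ ∈ valueSet φ₂`:
  up-probability `2^−(j₁+j₂−j)` over `valueSet φ` when `j < j₁ + j₂`, not a `(j₁+j₂−j−1)`-bit dyadic:
  the mixed subnormal term is exact — E5M2·E5M2 → binary16 needs exactly `8` bits for the product
  rounding, E4M3·E5M2 → binary16 exactly `1`, bfloat16·bfloat16 → binary32 exactly `117`
  (`mixed_law_exact_pipelines`).
-/

namespace Summit.Ventures.CertifiedArithmetic.LowPrec.SR.LimitedBits

open Literature.ComputerArithmetic.P3109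
open Literature.ComputerArithmetic.ConnollyHighamMary2021
open Literature.ComputerArithmetic.FloatingPoint (Format MiniFloat)
open Literature.ComputerArithmetic.FloatingPoint.MiniFloat (valueSet valueSet_nonempty)
open Summit.Ventures.CertifiedArithmetic.LowPrec.SR
open Finset

/-! ### The bottom cell in closed form -/

/-- **The bottom cell.** For `0 < δ < quantum` (and a format with a nonzero value), the exact-SR
up-probability of `δ` over `valueSet φ` is `δ / quantum`: the candidates are `0` and `quantum`. -/
theorem pUp_valueSet_small (φ : Format) (h1 : 1 ≤ φ.maxScaled) {δ : ℚ} (h0 : 0 < δ)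
    (hδ : δ < φ.quantum) : pUp (valueSet φ) δ = δ / φ.quantum := by
  have hq := φ.quantum_pos
  have hqm : φ.quantum ≤ φ.maxRat := by
    unfold Format.maxRat
    have : (1 : ℚ) ≤ φ.maxScaled := by exact_mod_cast h1
    nlinarith
  have hca : |δ| = δ := abs_of_pos h0
  have hcm : |δ| ≤ φ.maxRat := by rw [hca]; linarith
  have hin : InHull (valueSet φ) δ := (valueSet_inHull_iff φ _).mpr hcm
  unfold pUp; rw [clamp_eq_self hin]
  have hr0 : 0 ≤ |δ| / φ.quantum := div_nonneg (abs_nonneg _) hq.le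
  have hr1 : |δ| / φ.quantum < 1 := by rw [hca, div_lt_one hq]; exact hδ
  have hle : |δ| / φ.quantum ≤ φ.maxScaled :=
    le_trans hr1.le (by exact_mod_cast h1)
  have hfl : ⌊|δ| / φ.quantum⌋ = 0 := by
    rw [Int.floor_eq_iff]; push_cast; constructor <;> linarith
  have hs : φ.shift ⌊|δ| / φ.quantum⌋.toNat = 0 := by
    rw [hfl, Int.toNat_zero]; exact Format.shift_eq_zero_of_lt (by positivity)
  have hceil : ⌈|δ| / φ.quantum⌉ = 1 := by
    rw [Int.ceil_eq_iff]; push_cast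
    exact ⟨by rw [sub_self]; exact div_pos (by rw [hca]; exact h0) hq, hr1.le⟩
  unfold probUp
  rw [MiniFloat.chm_roundDown_eq hcm, MiniFloat.chm_roundUp_eq hcm, MiniFloat.toRat_roundDown,
    MiniFloat.toRat_roundUp, if_neg (not_lt.mpr h0.le), if_neg (not_lt.mpr h0.le),
    Format.rdGrid_cast hr0 hle, Format.ruGrid_cast hr0 hle, hs, pow_zero, div_one, hfl, hceil]
  norm_num

/-! ### The subnormal term of the product law is attained, every format -/

/-- **The product law is exact in the subnormal regime.** For a format with a nonzero value and
`j = bias + m − 1 ≥ 1`... precisely `bias + m ≥ 3` (so `j ≥ 2` and the witness is one bit below): the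
format value `quantum` times itself has exact product `quantum² < quantum`, whose up-probability over
the value set is `quantum²/quantum = 2^−j` — a `j`-bit dyadic that is not a `(j−1)`-bit dyadic, and
rule `A` with `j − 1` bits never rounds it up. -/
theorem valueSet_prod_law_sharp (φ : Format) (h1 : 1 ≤ φ.maxScaled) (hj : 3 ≤ φ.bias + φ.manBits) :
    φ.quantum ∈ valueSet φ ∧
    pUp (valueSet φ) (φ.quantum * φ.quantum) = 1 / 2 ^ (φ.bias + φ.manBits - 1) ∧
    ¬ Dyadic (φ.bias + φ.manBits - 2) (pUp (valueSet φ) (φ.quantum * φ.quantum)) ∧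
    Dyadic (φ.bias + φ.manBits - 1) (pUp (valueSet φ) (φ.quantum * φ.quantum)) ∧
    probAwayA (φ.bias + φ.manBits - 2) (pUp (valueSet φ) (φ.quantum * φ.quantum)) = 0 := by
  have hq := φ.quantum_pos
  have hqj := Format.quantum_eq_inv_two_pow (φ := φ) (by omega)
  have hq1 : φ.quantum < 1 := by
    rw [hqj, div_lt_one (by positivity)]
    exact one_lt_pow₀ (by norm_num) (by omega)
  have hv : pUp (valueSet φ) (φ.quantum * φ.quantum) = 1 / 2 ^ (φ.bias + φ.manBits - 1) := by
    rw [pUp_valueSet_small φ h1 (mul_pos hq hq) (by nlinarith), hqj]; field_simp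
  refine ⟨MiniFloat.quantum_mem_valueSet h1, hv, ?_, ?_, ?_⟩
  · rw [hv, dyadic_one_div_two_pow_iff]; omega
  · rw [hv, dyadic_one_div_two_pow_iff]
  · rw [hv]
    apply probAwayA_eq_zero _ (by positivity)
    rw [div_lt_div_iff_of_pos_left one_pos (by positivity) (by positivity)]
    exact pow_lt_pow_right₀ (by norm_num) (by omega)

/-- **The one-format product law `max (m+1) j` is exact whenever `j ≥ m + 1`, no enumeration:**
binary16 (`24`), bfloat16 (`133`), binary32 (`149`), E4M3 (`9`), E5M2 (`16`), E3M2 (`4`) — the product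
`quantum · quantum` needs exactly that many bits (up-probability `2^−j`, not a `(j−1)`-bit dyadic). -/
theorem prod_law_exact_formats :
    (pUp (valueSet Format.Binary16) (Format.Binary16.quantum * Format.Binary16.quantum) = 1 / 2 ^ 24 ∧
      ¬ Dyadic 23 (pUp (valueSet Format.Binary16)
        (Format.Binary16.quantum * Format.Binary16.quantum))) ∧
    (pUp (valueSet Format.BFloat16) (Format.BFloat16.quantum * Format.BFloat16.quantum)
        = 1 / 2 ^ 133 ∧
      ¬ Dyadic 132 (pUp (valueSet Format.BFloat16)
        (Format.BFloat16.quantum * Format.BFloat16.quantum))) ∧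
    (pUp (valueSet Format.Binary32) (Format.Binary32.quantum * Format.Binary32.quantum)
        = 1 / 2 ^ 149 ∧
      ¬ Dyadic 148 (pUp (valueSet Format.Binary32)
        (Format.Binary32.quantum * Format.Binary32.quantum))) ∧
    (pUp (valueSet Format.E4M3) (Format.E4M3.quantum * Format.E4M3.quantum) = 1 / 2 ^ 9 ∧
      ¬ Dyadic 8 (pUp (valueSet Format.E4M3) (Format.E4M3.quantum * Format.E4M3.quantum))) ∧
    (pUp (valueSet Format.E5M2) (Format.E5M2.quantum * Format.E5M2.quantum) = 1 / 2 ^ 16 ∧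
      ¬ Dyadic 15 (pUp (valueSet Format.E5M2) (Format.E5M2.quantum * Format.E5M2.quantum))) ∧
    (pUp (valueSet Format.E3M2) (Format.E3M2.quantum * Format.E3M2.quantum) = 1 / 2 ^ 4 ∧
      ¬ Dyadic 3 (pUp (valueSet Format.E3M2) (Format.E3M2.quantum * Format.E3M2.quantum))) := by
  obtain ⟨-, a1, a2, -, -⟩ := valueSet_prod_law_sharp Format.Binary16 (by decide) (by decide)
  obtain ⟨-, b1, b2, -, -⟩ := valueSet_prod_law_sharp Format.BFloat16 (by decide) (by decide)
  obtain ⟨-, c1, c2, -, -⟩ := valueSet_prod_law_sharp Format.Binary32 (by decide) (by decide)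
  obtain ⟨-, d1, d2, -, -⟩ := valueSet_prod_law_sharp Format.E4M3 (by decide) (by decide)
  obtain ⟨-, e1, e2, -, -⟩ := valueSet_prod_law_sharp Format.E5M2 (by decide) (by decide)
  obtain ⟨-, f1, f2, -, -⟩ := valueSet_prod_law_sharp Format.E3M2 (by decide) (by decide)
  exact ⟨⟨a1, a2⟩, ⟨b1, b2⟩, ⟨c1, c2⟩, ⟨d1, d2⟩, ⟨e1, e2⟩, ⟨f1, f2⟩⟩

/-! ### The subnormal term of the mixed law is attained -/

/-- **The mixed product law is exact in the accumulator's subnormal regime.** Factors `quantum₁`,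
`quantum₂` (format values of `φ₁`, `φ₂`); if `j < j₁ + j₂` their exact product `2^−(j₁+j₂)` lies
strictly inside the bottom cell of the accumulator `φ` and rounds with up-probability
`2^−(j₁+j₂−j)` — a `(j₁+j₂−j)`-bit dyadic, not one bit less, and rule `A` one bit short is dead. -/
theorem valueSet_mixed_law_sharp (φ φ₁ φ₂ : Format) (hm : 1 ≤ φ.maxScaled) (hm₁ : 1 ≤ φ₁.maxScaled)
    (hm₂ : 1 ≤ φ₂.maxScaled) (h : 1 ≤ φ.bias + φ.manBits) (h₁ : 1 ≤ φ₁.bias + φ₁.manBits)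
    (h₂ : 1 ≤ φ₂.bias + φ₂.manBits)
    (hlt : φ.bias + φ.manBits - 1 < φ₁.bias + φ₁.manBits - 1 + (φ₂.bias + φ₂.manBits - 1)) :
    (φ₁.quantum ∈ valueSet φ₁ ∧ φ₂.quantum ∈ valueSet φ₂) ∧
    pUp (valueSet φ) (φ₁.quantum * φ₂.quantum)
      = 1 / 2 ^ (φ₁.bias + φ₁.manBits - 1 + (φ₂.bias + φ₂.manBits - 1) - (φ.bias + φ.manBits - 1)) ∧
    ¬ Dyadic (φ₁.bias + φ₁.manBits - 1 + (φ₂.bias + φ₂.manBits - 1) - (φ.bias + φ.manBits - 1) - 1)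
      (pUp (valueSet φ) (φ₁.quantum * φ₂.quantum)) ∧
    Dyadic (φ₁.bias + φ₁.manBits - 1 + (φ₂.bias + φ₂.manBits - 1) - (φ.bias + φ.manBits - 1))
      (pUp (valueSet φ) (φ₁.quantum * φ₂.quantum)) ∧
    probAwayA (φ₁.bias + φ₁.manBits - 1 + (φ₂.bias + φ₂.manBits - 1) - (φ.bias + φ.manBits - 1) - 1)
      (pUp (valueSet φ) (φ₁.quantum * φ₂.quantum)) = 0 := by
  set j := φ.bias + φ.manBits - 1 with hj
  set j₁ := φ₁.bias + φ₁.manBits - 1 with hj₁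
  set j₂ := φ₂.bias + φ₂.manBits - 1 with hj₂
  have hqj : φ.quantum = 1 / 2 ^ j := Format.quantum_eq_inv_two_pow h
  have hqj₁ : φ₁.quantum = 1 / 2 ^ j₁ := Format.quantum_eq_inv_two_pow h₁
  have hqj₂ : φ₂.quantum = 1 / 2 ^ j₂ := Format.quantum_eq_inv_two_pow h₂
  have hprod : φ₁.quantum * φ₂.quantum = 1 / 2 ^ (j₁ + j₂) := by
    rw [hqj₁, hqj₂, pow_add]; field_simp
  have hp0 : 0 < φ₁.quantum * φ₂.quantum := mul_pos φ₁.quantum_pos φ₂.quantum_pos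
  have hplt : φ₁.quantum * φ₂.quantum < φ.quantum := by
    rw [hprod, hqj, div_lt_div_iff_of_pos_left one_pos (by positivity) (by positivity)]
    exact pow_lt_pow_right₀ (by norm_num) hlt
  have hv : pUp (valueSet φ) (φ₁.quantum * φ₂.quantum) = 1 / 2 ^ (j₁ + j₂ - j) := by
    rw [pUp_valueSet_small φ hm hp0 hplt, hprod, hqj, div_div_eq_mul_div, div_one,
      div_mul_eq_mul_div, one_mul, div_eq_div_iff (by positivity) (by positivity), one_mul,
      ← pow_add, Nat.add_sub_of_le hlt.le]
  refine ⟨⟨MiniFloat.quantum_mem_valueSet hm₁, MiniFloat.quantum_mem_valueSet hm₂⟩, hv, ?_, ?_, ?_⟩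
  · rw [hv, dyadic_one_div_two_pow_iff]; omega
  · rw [hv, dyadic_one_div_two_pow_iff]
  · rw [hv]
    apply probAwayA_eq_zero _ (by positivity)
    rw [div_lt_div_iff_of_pos_left one_pos (by positivity) (by positivity)]
    exact pow_lt_pow_right₀ (by norm_num) (by omega)

set_option maxRecDepth 8192 in
/-- **The mixed subnormal term, closed forms:** the product of the least positive factor values needs
EXACTLY `8` bits to SR-round into binary16 for E5M2·E5M2 (`2⁻³² ↦` up-probability `2⁻⁸`), exactly
`1` for E4M3·E5M2 (`2⁻²⁵ ↦ 1/2`), and exactly `117` bits into binary32 for bfloat16·bfloat16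
(`2⁻²⁶⁶ ↦ 2⁻¹¹⁷`) — matching the mixed law `max (m₁+m₂+1∸m) (j₁+j₂∸j)` of LXXXIII on these pipelines. -/
theorem mixed_law_exact_pipelines :
    (pUp (valueSet Format.Binary16) (Format.E5M2.quantum * Format.E5M2.quantum) = 1 / 2 ^ 8 ∧
      ¬ Dyadic 7 (pUp (valueSet Format.Binary16) (Format.E5M2.quantum * Format.E5M2.quantum))) ∧
    (pUp (valueSet Format.Binary16) (Format.E4M3.quantum * Format.E5M2.quantum) = 1 / 2 ^ 1 ∧
      ¬ Dyadic 0 (pUp (valueSet Format.Binary16) (Format.E4M3.quantum * Format.E5M2.quantum))) ∧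
    (pUp (valueSet Format.Binary32) (Format.BFloat16.quantum * Format.BFloat16.quantum)
        = 1 / 2 ^ 117 ∧
      ¬ Dyadic 116 (pUp (valueSet Format.Binary32)
        (Format.BFloat16.quantum * Format.BFloat16.quantum))) := by
  obtain ⟨-, a1, a2, -, -⟩ := valueSet_mixed_law_sharp Format.Binary16 Format.E5M2 Format.E5M2
    (by decide) (by decide) (by decide) (by decide) (by decide) (by decide) (by decide)
  obtain ⟨-, b1, b2, -, -⟩ := valueSet_mixed_law_sharp Format.Binary16 Format.E4M3 Format.E5M2
    (by decide) (by decide) (by decide) (by decide) (by decide) (by decide) (by decide)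
  obtain ⟨-, c1, c2, -, -⟩ := valueSet_mixed_law_sharp Format.Binary32 Format.BFloat16 Format.BFloat16
    (by decide) (by decide) (by decide) (by decide) (by decide) (by decide) (by decide)
  exact ⟨⟨a1, a2⟩, ⟨b1, b2⟩, ⟨c1, c2⟩⟩

end Summit.Ventures.CertifiedArithmetic.LowPrec.SR.LimitedBits
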